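import Summits.CriticalPhenomena.PercolationContinuityZ3.Theorems.PercNearOneGluingNoHeavyLowerTailOutsiderPortStep
import Summits.CriticalPhenomena.PercolationContinuityZ3.Theorems.PercNearOneGluingNoHeavyLowerTailPairObserverLighterMember
import HarnessLib

/-!
# `NoHeavyLowerTail` (stmt-CriticalPhenomena-4575) — two pendant stars with INTEGRAL coins: the base of the (DC) induction, and the
# bookkeeping of deleting one fractional star pair

Support file (prover `prim-hp-3`, hull-port line; `--supports stmt-CriticalPhenomena-4575`).  No definitions, no named facts, no sorries.

SETTING (all hypotheses inline).  `μ_w = prodBernoulli w` on `Fin n`, relays `A`, level `j`; TWO PENDANT STARS: observers `o₁ ≠ o₂`, both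
`∉ A`, `w s(o₁,o₂) = 0`, every pair of nonzero weight at `o₁` or at `o₂` goes to a relay (the PORTS; shared ports allowed; star weights
arbitrary in `[0,1]`, weight `1` = glued port).  `O = {o₁,o₂}`, `π(v) = {z ∈ A : v ↔ z}`, `π(O) = π(o₁) ∪ π(o₂)`, `I_w(v) = μ_w{|π(v)| ≤ j}`,
E-mass `E_w(v) = μ_w(v ↮ O, 1 ≤ |π(O)| ≤ j) + μ_w(v ↔ O, |π(v)| ≤ j)` (file `…OutsiderPortStep.lean`).

* `HullPort.obsE_pair_le_of_glued_isolated`, `obsE_pair_eq_zero_of_isolated` — an isolated observer (all pairs of weight `0`) drops out a.s.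
  (support event, `CutObserver.measureReal_inter_support`); a glued observer is its port (`edgeSw_real_eq_of_sure`).
* `HullPort.obsE_pair_le_port_of_integral` (**BASE of the (DC) induction**): if every star pair `s(o_s,a)`, `a ∈ A`, has weight `0` or `1`, then
  for every relay `v ∈ A` there is a relay `p ∈ A` which is a port (or `E_w(v) = 0`) with `E_w(v) ≤ I_w(p)`  (both glued: `obsE_pair_le_lighter`
  + `lightness_eq_of_weight_one`).
* `HullPort.twoStars_erase` — deleting one fractional star pair keeps the two-pendant-stars shape, is dominated by the old weight function, and
  lowers the number of fractional star pairs (the measure of the induction in `…DCInductionShell.lean`).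
WHY: crux notes `run/shared/lean/prim/prim-hp-3/HULLPORT-REF-gen6.md` §9 — the (DC) induction for the two-sided kernel.
-/

noncomputable section

namespace Summit.CriticalPhenomena.PercolationContinuityZ3.Theorems

open MeasureTheory Set Literature.Probability.LatticeModels Literature.Probability.Percolation
open scoped Classical BigOperators

variable {n : ℕ}

namespace HullPort

/-! ### Isolated observers: null events -/

/-- With `o₂` isolated (all pairs at `o₂` of weight zero), `o₁` glued to a relay `t` (`w s(o₁,t) = 1`) and `v ∈ A`, the E-mass of `v` for
`O = {o₁,o₂}` is at most `I_w(t)`: a.s. `π(O) = π(t)` and `v ↔ O ↔ v ↔ t`. [this work] -/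
theorem obsE_pair_le_of_glued_isolated (w : Sym2 (Fin n) → unitInterval) (A : Finset (Fin n)) (o₁ o₂ t v : Fin n) (j : ℕ)
    (h12 : o₁ ≠ o₂) (ho₁A : o₁ ∉ A) (ho₂A : o₂ ∉ A) (htA : t ∈ A) (hvA : v ∈ A)
    (hglue : w s(o₁, t) = 1) (hiso : ∀ u, w s(o₂, u) = 0) :
    (prodBernoulli w).real {ω : BondConfig (Fin n) | (∀ x ∈ ({o₁, o₂} : Finset (Fin n)), ω ∉ openConn v x) ∧
        1 ≤ (A.filter fun z => ∃ x ∈ ({o₁, o₂} : Finset (Fin n)), ω ∈ openConn x z).card ∧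
        (A.filter fun z => ∃ x ∈ ({o₁, o₂} : Finset (Fin n)), ω ∈ openConn x z).card ≤ j} +
      (prodBernoulli w).real {ω : BondConfig (Fin n) | (∃ x ∈ ({o₁, o₂} : Finset (Fin n)), ω ∈ openConn v x) ∧
        (A.filter fun z => ω ∈ openConn v z).card ≤ j} ≤
      (prodBernoulli w).real {ω : BondConfig (Fin n) | (A.filter fun z => ω ∈ openConn t z).card ≤ j} := by
  haveI : IsProbabilityMeasure (prodBernoulli w) := inferInstance
  set O : Finset (Fin n) := {o₁, o₂} with hO
  set S1 : Set (BondConfig (Fin n)) := {ω | (∀ x ∈ O, ω ∉ openConn v x) ∧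
        1 ≤ (A.filter fun z => ∃ x ∈ O, ω ∈ openConn x z).card ∧
        (A.filter fun z => ∃ x ∈ O, ω ∈ openConn x z).card ≤ j} with hS1
  set S2 : Set (BondConfig (Fin n)) := {ω | (∃ x ∈ O, ω ∈ openConn v x) ∧
        (A.filter fun z => ω ∈ openConn v z).card ≤ j} with hS2
  set Rt : Set (BondConfig (Fin n)) := {ω | (A.filter fun z => ω ∈ openConn t z).card ≤ j} with hRt
  set G : Set (BondConfig (Fin n)) := {ω | ∀ e ∈ ω, w e ≠ 0} with hG
  have hmeas : ∀ S : Set (BondConfig (Fin n)), MeasurableSet S := fun S => (Set.toFinite S).measurableSet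
  have hvo₂ : v ≠ o₂ := fun h => ho₂A (h ▸ hvA)
  have hto₁ : t ≠ o₁ := fun h => ho₁A (h ▸ htA)
  -- on the support event, `o₂` reaches nothing but itself
  have hiso' : ∀ ω ∈ G, ∀ z, z ≠ o₂ → ¬ (openGraph ω).Reachable o₂ z := by
    intro ω hωG z hz hr
    obtain ⟨wk⟩ := hr
    cases wk with
    | nil => exact absurd rfl hz.symm
    | @cons _ u _ hadj _ =>
      rw [openGraph, SimpleGraph.fromEdgeSet_adj] at hadj
      exact hωG _ hadj.1 (hiso u)
  -- on `{s(o₁,t) open}`, `o₁` and `t` have the same cluster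
  have hot : ∀ ω : BondConfig (Fin n), s(o₁, t) ∈ ω → ∀ z, ((openGraph ω).Reachable o₁ z ↔ (openGraph ω).Reachable t z) := by
    intro ω he z
    have hadj : (openGraph ω).Adj o₁ t := (openGraph_adj ω o₁ t).mpr ⟨he, hto₁.symm⟩
    exact ⟨fun h => hadj.symm.reachable.trans h, fun h => hadj.reachable.trans h⟩
  -- reduce both events to the support and to `{s(o₁,t) open}`
  have hred : ∀ S : Set (BondConfig (Fin n)), (prodBernoulli w).real S = (prodBernoulli w).real (S ∩ G ∩ {ω | s(o₁, t) ∈ ω}) := by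
    intro S
    rw [← CutObserver.measureReal_inter_support w S]
    apply edgeSw_real_eq_of_sure w s(o₁, t) hglue
    intro ω he
    simp only [mem_inter_iff, mem_setOf_eq]
    tauto
  have h1 : (prodBernoulli w).real S1 ≤ (prodBernoulli w).real (Rt ∩ (openConn v t : Set (BondConfig (Fin n)))ᶜ) := by
    rw [hred S1]
    refine measureReal_mono ?_ (measure_ne_top _ _)
    rintro ω ⟨⟨⟨hsep, -, hle⟩, hωG⟩, he⟩
    refine ⟨?_, ?_⟩
    · change (A.filter fun z => ω ∈ openConn t z).card ≤ j
      refine le_trans (Finset.card_le_card ?_) hle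
      intro z hz
      rw [Finset.mem_filter] at hz ⊢
      exact ⟨hz.1, o₁, by simp [hO], ((hot ω he z).2 hz.2 : (openGraph ω).Reachable o₁ z)⟩
    · intro hvt
      apply hsep o₁ (by simp [hO])
      change (openGraph ω).Reachable v t at hvt
      change (openGraph ω).Reachable v o₁
      exact hvt.trans ((hot ω he t).2 (SimpleGraph.Reachable.refl t)).symm
  have h2 : (prodBernoulli w).real S2 ≤ (prodBernoulli w).real (Rt ∩ (openConn v t : Set (BondConfig (Fin n)))) := by
    rw [hred S2]
    refine measureReal_mono ?_ (measure_ne_top _ _)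
    rintro ω ⟨⟨⟨⟨x, hx, hvx⟩, hle⟩, hωG⟩, he⟩
    have hvt : (openGraph ω).Reachable v t := by
      simp only [hO, Finset.mem_insert, Finset.mem_singleton] at hx
      rcases hx with rfl | rfl
      · exact (hvx : (openGraph ω).Reachable v x).trans ((hot ω he t).2 (SimpleGraph.Reachable.refl t))
      · exact absurd (hvx : (openGraph ω).Reachable v x).symm (hiso' ω hωG v hvo₂)
    refine ⟨?_, hvt⟩
    change (A.filter fun z => ω ∈ openConn t z).card ≤ j
    have heq : (A.filter fun z => ω ∈ openConn t z) = (A.filter fun z => ω ∈ openConn v z) := by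
      apply Finset.filter_congr
      intro z _
      change (openGraph ω).Reachable t z ↔ (openGraph ω).Reachable v z
      exact ⟨fun h => hvt.trans h, fun h => hvt.symm.trans h⟩
    rw [heq]; exact hle
  have hsplit := measureReal_inter_add_sdiff (μ := prodBernoulli w) (s := Rt) (hmeas (openConn v t : Set (BondConfig (Fin n))))
  have hsd : Rt \ (openConn v t : Set (BondConfig (Fin n))) = Rt ∩ (openConn v t : Set (BondConfig (Fin n)))ᶜ := by
    ext ω; simp only [mem_sdiff, mem_inter_iff, mem_compl_iff]
  rw [hsd] at hsplit
  linarith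

/-- With BOTH observers isolated and `v ∈ A`, the E-mass of `v` for `O = {o₁,o₂}` vanishes. [this work] -/
theorem obsE_pair_eq_zero_of_isolated (w : Sym2 (Fin n) → unitInterval) (A : Finset (Fin n)) (o₁ o₂ v : Fin n) (j : ℕ)
    (ho₁A : o₁ ∉ A) (ho₂A : o₂ ∉ A) (hvA : v ∈ A)
    (hiso₁ : ∀ u, w s(o₁, u) = 0) (hiso₂ : ∀ u, w s(o₂, u) = 0) :
    (prodBernoulli w).real {ω : BondConfig (Fin n) | (∀ x ∈ ({o₁, o₂} : Finset (Fin n)), ω ∉ openConn v x) ∧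
        1 ≤ (A.filter fun z => ∃ x ∈ ({o₁, o₂} : Finset (Fin n)), ω ∈ openConn x z).card ∧
        (A.filter fun z => ∃ x ∈ ({o₁, o₂} : Finset (Fin n)), ω ∈ openConn x z).card ≤ j} +
      (prodBernoulli w).real {ω : BondConfig (Fin n) | (∃ x ∈ ({o₁, o₂} : Finset (Fin n)), ω ∈ openConn v x) ∧
        (A.filter fun z => ω ∈ openConn v z).card ≤ j} = 0 := by
  set O : Finset (Fin n) := {o₁, o₂} with hO
  set G : Set (BondConfig (Fin n)) := {ω | ∀ e ∈ ω, w e ≠ 0} with hG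
  have hiso' : ∀ ω ∈ G, ∀ x ∈ O, ∀ z, z ≠ x → ¬ (openGraph ω).Reachable x z := by
    intro ω hωG x hx z hz hr
    simp only [hO, Finset.mem_insert, Finset.mem_singleton] at hx
    obtain ⟨wk⟩ := hr
    cases wk with
    | nil => exact absurd rfl hz
    | @cons _ u _ hadj _ =>
      rw [openGraph, SimpleGraph.fromEdgeSet_adj] at hadj
      rcases hx with rfl | rfl
      · exact hωG _ hadj.1 (hiso₁ u)
      · exact hωG _ hadj.1 (hiso₂ u)
  have hxA : ∀ x ∈ O, x ∉ A := by
    intro x hx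
    simp only [hO, Finset.mem_insert, Finset.mem_singleton] at hx
    rcases hx with rfl | rfl
    · exact ho₁A
    · exact ho₂A
  have h1 : (prodBernoulli w).real {ω : BondConfig (Fin n) | (∀ x ∈ O, ω ∉ openConn v x) ∧
        1 ≤ (A.filter fun z => ∃ x ∈ O, ω ∈ openConn x z).card ∧
        (A.filter fun z => ∃ x ∈ O, ω ∈ openConn x z).card ≤ j} = 0 := by
    rw [← CutObserver.measureReal_inter_support]
    have he : {ω : BondConfig (Fin n) | (∀ x ∈ O, ω ∉ openConn v x) ∧
        1 ≤ (A.filter fun z => ∃ x ∈ O, ω ∈ openConn x z).card ∧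
        (A.filter fun z => ∃ x ∈ O, ω ∈ openConn x z).card ≤ j} ∩ {ω | ∀ e ∈ ω, w e ≠ 0} = ∅ := by
      refine Set.eq_empty_iff_forall_notMem.2 ?_
      rintro ω ⟨⟨-, hcard, -⟩, hωG⟩
      obtain ⟨z, hz⟩ := Finset.card_pos.1 (by omega : 0 < (A.filter fun z => ∃ x ∈ O, ω ∈ openConn x z).card)
      rw [Finset.mem_filter] at hz
      obtain ⟨hzA, x, hx, hxz⟩ := hz
      exact hiso' ω hωG x hx z (fun h => hxA x hx (h ▸ hzA)) hxz
    rw [he, measureReal_empty]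
  have h2 : (prodBernoulli w).real {ω : BondConfig (Fin n) | (∃ x ∈ O, ω ∈ openConn v x) ∧
        (A.filter fun z => ω ∈ openConn v z).card ≤ j} = 0 := by
    rw [← CutObserver.measureReal_inter_support]
    have he : {ω : BondConfig (Fin n) | (∃ x ∈ O, ω ∈ openConn v x) ∧
        (A.filter fun z => ω ∈ openConn v z).card ≤ j} ∩ {ω | ∀ e ∈ ω, w e ≠ 0} = ∅ := by
      refine Set.eq_empty_iff_forall_notMem.2 ?_
      rintro ω ⟨⟨⟨x, hx, hvx⟩, -⟩, hωG⟩
      exact hiso' ω hωG x hx v (fun h => hxA x hx (h ▸ hvA)) (hvx : (openGraph ω).Reachable v x).symm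
    rw [he, measureReal_empty]
  rw [h1, h2, add_zero]

/-- **BASE of the induction (all star pairs of weight `0` or `1`).**  Two pendant stars in which every pair `s(o_s,a)`, `a ∈ A`, has weight
`0` or `1`: for every relay `v ∈ A` there is a relay `p ∈ A` which is a port (or `E_w(v) = 0`) with `E_w(v) ≤ I_w(p)`.  (Both observers
glued: `obsE_pair_le_lighter` + glued lightness; one glued, one isolated: `obsE_pair_le_of_glued_isolated`; both isolated: the E-mass vanishes.)
[this work] -/
theorem obsE_pair_le_port_of_integral (w : Sym2 (Fin n) → unitInterval) (A : Finset (Fin n)) (o₁ o₂ : Fin n) (j : ℕ)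
    (ho₁A : o₁ ∉ A) (ho₂A : o₂ ∉ A) (h12 : o₁ ≠ o₂)
    (hpend₁ : ∀ u, w s(o₁, u) ≠ 0 → u ∈ A) (hpend₂ : ∀ u, w s(o₂, u) ≠ 0 → u ∈ A)
    (hint : ∀ a ∈ A, (w s(o₁, a) = 0 ∨ w s(o₁, a) = 1) ∧ (w s(o₂, a) = 0 ∨ w s(o₂, a) = 1)) :
    ∀ v ∈ A, ∃ p ∈ A, ((prodBernoulli w).real {ω : BondConfig (Fin n) | (∀ x ∈ ({o₁, o₂} : Finset (Fin n)), ω ∉ openConn v x) ∧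
          1 ≤ (A.filter fun z => ∃ x ∈ ({o₁, o₂} : Finset (Fin n)), ω ∈ openConn x z).card ∧
          (A.filter fun z => ∃ x ∈ ({o₁, o₂} : Finset (Fin n)), ω ∈ openConn x z).card ≤ j} +
        (prodBernoulli w).real {ω : BondConfig (Fin n) | (∃ x ∈ ({o₁, o₂} : Finset (Fin n)), ω ∈ openConn v x) ∧
          (A.filter fun z => ω ∈ openConn v z).card ≤ j} = 0 ∨ w s(o₁, p) ≠ 0 ∨ w s(o₂, p) ≠ 0) ∧
      (prodBernoulli w).real {ω : BondConfig (Fin n) | (∀ x ∈ ({o₁, o₂} : Finset (Fin n)), ω ∉ openConn v x) ∧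
          1 ≤ (A.filter fun z => ∃ x ∈ ({o₁, o₂} : Finset (Fin n)), ω ∈ openConn x z).card ∧
          (A.filter fun z => ∃ x ∈ ({o₁, o₂} : Finset (Fin n)), ω ∈ openConn x z).card ≤ j} +
        (prodBernoulli w).real {ω : BondConfig (Fin n) | (∃ x ∈ ({o₁, o₂} : Finset (Fin n)), ω ∈ openConn v x) ∧
          (A.filter fun z => ω ∈ openConn v z).card ≤ j} ≤
      (prodBernoulli w).real {ω : BondConfig (Fin n) | (A.filter fun z => ω ∈ openConn p z).card ≤ j} := by
  intro v hvA
  -- an observer with no glued port is isolated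
  have iso_of : ∀ o : Fin n, (∀ u, w s(o, u) ≠ 0 → u ∈ A) → (∀ a ∈ A, w s(o, a) = 0 ∨ w s(o, a) = 1) →
      (¬ ∃ a ∈ A, w s(o, a) = 1) → ∀ u, w s(o, u) = 0 := by
    intro o hpend hint' hno u
    by_contra hne
    have huA := hpend u hne
    rcases hint' u huA with h | h
    · exact hne h
    · exact hno ⟨u, huA, h⟩
  have hint₁ : ∀ a ∈ A, w s(o₁, a) = 0 ∨ w s(o₁, a) = 1 := fun a ha => (hint a ha).1
  have hint₂ : ∀ a ∈ A, w s(o₂, a) = 0 ∨ w s(o₂, a) = 1 := fun a ha => (hint a ha).2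
  by_cases g₁ : ∃ a ∈ A, w s(o₁, a) = 1
  · obtain ⟨t₁, ht₁A, ht₁⟩ := g₁
    by_cases g₂ : ∃ a ∈ A, w s(o₂, a) = 1
    · obtain ⟨t₂, ht₂A, ht₂⟩ := g₂
      -- both glued: the lighter glued observer bounds the E-mass
      have hI₁ := lightness_eq_of_weight_one w A (fun h => ho₁A (h ▸ ht₁A) : o₁ ≠ t₁) j ht₁
      have hI₂ := lightness_eq_of_weight_one w A (fun h => ho₂A (h ▸ ht₂A) : o₂ ≠ t₂) j ht₂
      rcases le_total ((prodBernoulli w).real {ω : BondConfig (Fin n) | (A.filter fun x => ω ∈ openConn o₂ x).card ≤ j})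
          ((prodBernoulli w).real {ω : BondConfig (Fin n) | (A.filter fun x => ω ∈ openConn o₁ x).card ≤ j}) with hle | hle
      · refine ⟨t₁, ht₁A, Or.inr (Or.inl (by rw [ht₁]; exact one_ne_zero)), ?_⟩
        have h := obsE_pair_le_lighter w A o₁ o₂ v j h12 hle
        rw [hI₁] at h
        exact h
      · refine ⟨t₂, ht₂A, Or.inr (Or.inr (by rw [ht₂]; exact one_ne_zero)), ?_⟩
        have h := obsE_pair_le_lighter w A o₂ o₁ v j h12.symm hle
        rw [hI₂] at h
        have hswap : ({o₂, o₁} : Finset (Fin n)) = {o₁, o₂} := Finset.pair_comm o₂ o₁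
        rw [hswap] at h
        exact h
    · -- `o₂` isolated, `o₁` glued to `t₁`
      have hiso₂ := iso_of o₂ hpend₂ hint₂ g₂
      exact ⟨t₁, ht₁A, Or.inr (Or.inl (by rw [ht₁]; exact one_ne_zero)),
        obsE_pair_le_of_glued_isolated w A o₁ o₂ t₁ v j h12 ho₁A ho₂A ht₁A hvA ht₁ hiso₂⟩
  · have hiso₁ := iso_of o₁ hpend₁ hint₁ g₁
    by_cases g₂ : ∃ a ∈ A, w s(o₂, a) = 1
    · obtain ⟨t₂, ht₂A, ht₂⟩ := g₂
      refine ⟨t₂, ht₂A, Or.inr (Or.inr (by rw [ht₂]; exact one_ne_zero)), ?_⟩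
      have h := obsE_pair_le_of_glued_isolated w A o₂ o₁ t₂ v j h12.symm ho₂A ho₁A ht₂A hvA ht₂ hiso₁
      have hswap : ({o₂, o₁} : Finset (Fin n)) = {o₁, o₂} := Finset.pair_comm o₂ o₁
      rw [hswap] at h
      exact h
    · have hiso₂ := iso_of o₂ hpend₂ hint₂ g₂
      have h0 := obsE_pair_eq_zero_of_isolated w A o₁ o₂ v j ho₁A ho₂A hvA hiso₁ hiso₂
      refine ⟨v, hvA, Or.inl h0, ?_⟩
      rw [h0]
      exact measureReal_nonneg

/-! ### Deleting a fractional star pair -/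

/-- Deleting one fractional star pair `s(a,o)` (`o ∈ {o₁,o₂}`, `a ∈ A`) of a two-pendant-stars weight function gives a two-pendant-stars
weight function with fewer fractional star pairs, dominated by the old one. [folklore] -/
theorem twoStars_erase (u : Sym2 (Fin n) → unitInterval) (A : Finset (Fin n)) (o₁ o₂ o a : Fin n)
    (ho₁A : o₁ ∉ A) (ho₂A : o₂ ∉ A) (ho : o ∈ ({o₁, o₂} : Finset (Fin n))) (haA : a ∈ A)
    (hu12 : u s(o₁, o₂) = 0) (hp₁ : ∀ x, u s(o₁, x) ≠ 0 → x ∈ A) (hp₂ : ∀ x, u s(o₂, x) ≠ 0 → x ∈ A)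
    (hne0 : u s(o, a) ≠ 0) (hne1 : u s(o, a) ≠ 1) :
    (Function.update u s(a, o) 0) s(o₁, o₂) = 0 ∧
    (∀ x, (Function.update u s(a, o) 0) s(o₁, x) ≠ 0 → x ∈ A) ∧ (∀ x, (Function.update u s(a, o) 0) s(o₂, x) ≠ 0 → x ∈ A) ∧
    (∀ e, (Function.update u s(a, o) 0) e ≠ 0 → u e ≠ 0) ∧
    ((A.filter fun x => (Function.update u s(a, o) 0) s(o₁, x) ≠ 0 ∧ (Function.update u s(a, o) 0) s(o₁, x) ≠ 1).card + (A.filter fun x => (Function.update u s(a, o) 0) s(o₂, x) ≠ 0 ∧ (Function.update u s(a, o) 0) s(o₂, x) ≠ 1).card) <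
      ((A.filter fun x => u s(o₁, x) ≠ 0 ∧ u s(o₁, x) ≠ 1).card + (A.filter fun x => u s(o₂, x) ≠ 0 ∧ u s(o₂, x) ≠ 1).card) := by
  set u₀ := Function.update u s(a, o) 0 with hu₀
  have hkey : s(a, o) = s(o, a) := Sym2.eq_swap
  have hu₀_of_ne : ∀ e, e ≠ s(a, o) → u₀ e = u e := fun e he => by rw [hu₀, Function.update_of_ne he]
  have hne12 : s(o₁, o₂) ≠ s(a, o) := by
    intro h
    have : a ∈ s(o₁, o₂) := by rw [h]; exact Sym2.mem_mk_left a o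
    rcases Sym2.mem_iff.1 this with h' | h'
    · exact ho₁A (h' ▸ haA)
    · exact ho₂A (h' ▸ haA)
  have hle₀ : ∀ e, u₀ e ≠ 0 → u e ≠ 0 := by
    intro e he
    by_cases h : e = s(a, o)
    · rw [h, hu₀, Function.update_self] at he; exact absurd rfl he
    · rwa [hu₀_of_ne e h] at he
  refine ⟨by rw [hu₀_of_ne _ hne12]; exact hu12, fun x hx => hp₁ x (hle₀ _ hx), fun x hx => hp₂ x (hle₀ _ hx), hle₀, ?_⟩
  have hsub : ∀ o' : Fin n, (A.filter fun x => u₀ s(o', x) ≠ 0 ∧ u₀ s(o', x) ≠ 1) ⊆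
      (A.filter fun x => u s(o', x) ≠ 0 ∧ u s(o', x) ≠ 1) := by
    intro o' x hx
    rw [Finset.mem_filter] at hx ⊢
    refine ⟨hx.1, ?_⟩
    by_cases h : s(o', x) = s(a, o)
    · rw [h, hu₀, Function.update_self] at hx; exact absurd rfl hx.2.1
    · rw [hu₀_of_ne _ h] at hx; exact hx.2
  have hamem : a ∈ (A.filter fun x => u s(o, x) ≠ 0 ∧ u s(o, x) ≠ 1) := Finset.mem_filter.2 ⟨haA, hne0, hne1⟩
  have hanot : a ∉ (A.filter fun x => u₀ s(o, x) ≠ 0 ∧ u₀ s(o, x) ≠ 1) := by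
    intro h
    rw [Finset.mem_filter, ← hkey, hu₀, Function.update_self] at h
    exact h.2.1 rfl
  have hlt_o : (A.filter fun x => u₀ s(o, x) ≠ 0 ∧ u₀ s(o, x) ≠ 1).card <
      (A.filter fun x => u s(o, x) ≠ 0 ∧ u s(o, x) ≠ 1).card :=
    Finset.card_lt_card ⟨hsub o, fun h => hanot (h hamem)⟩
  have hle₁ := Finset.card_le_card (hsub o₁)
  have hle₂ := Finset.card_le_card (hsub o₂)
  simp only [Finset.mem_insert, Finset.mem_singleton] at ho
  rcases ho with rfl | rfl
  · omega
  · omega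


end HullPort

end Summit.CriticalPhenomena.PercolationContinuityZ3.Theorems

end
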